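import Summits.ValiantsHypothesis.ValiantsHypothesis.Theorems.GrenetZeonPolySizeQPAlgebraNilradicalDepthBox
import HarnessLib

/-!
# Local decomposition of `(m, s)`-representations

Helper file for the pieces `PolySizeQPAlgebra` (stmt-ValiantsHypothesis-8064) and `AbelianizationQP`
(stmt-8063) of route `GrenetZeon`; companion of `GrenetZeonPolySizeQPAlgebraNilradicalDepth.lean`.
It supplies the normal form announced but not provided by the Literature file `AlgDetRepr.lean`
(«the product decomposition of a representation along `R ≅ ∏ Rᵢ` (sum of local contributions)»):

over an algebraically closed field `k`, every representation `f = λ(det A)` over a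
finite-dimensional commutative coefficient algebra `R` (`dim R ≤ s`, `(nilradical R)^ν = 0`) is a
SUM of at most `s` representations OF THE SAME MATRIX SIZE over LOCAL algebras `Rᵢ` with residue
field `k` — characters `φᵢ : Rᵢ → k` with `(ker φᵢ)^ν = 0` — whose dimensions add up to at most `s`
(`R ≅ ∏_𝔪 R ⧸ 𝔪^ν`, `IsArtinianRing.quotNilradicalPowEquivPi`).  Together with additivity
(`hasAlgDetRepr_finset_sum`) this reduces every question about the two-parameter model to LOCAL
coefficient algebras (where `eq_sum_dets_of_depth`, the trace/socle readings and the
Gorenstein/apolar language of the crux `AbelianizationQP` live), at no cost in `m` or `s`.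

## Main results

* `exists_local_decomposition` — the statement above, depth-`ν` form.
* `exists_local_decomposition_of_hasAlgDetRepr` — `HasAlgDetRepr f m s` ⟹ `f = Σ_{i<t} fᵢ`,
  `t ≤ s`, `fᵢ` represented over local algebras of depth `≤ s` with `Σ dim ≤ s`.

No stub of the line is closed; `VP ≠ VNP` is not touched.

## References

* P. Hrubeš, A. Yehudayoff, *Arithmetic complexity in ring extensions*, Theory of Computing 7
  (2011), §2. [cite: HrubesYehudayoff2011, §2]
* Structure of Artinian rings (Atiyah–Macdonald, Thm. 8.7): Mathlib
  `IsArtinianRing.quotNilradicalPowEquivPi`.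
-/

set_option linter.dupNamespace false

noncomputable section

namespace Summit.ValiantsHypothesis.ValiantsHypothesis.Theorems.GrenetZeonPolySizeQPAlgebra

open MvPolynomial Matrix
open Literature.Computability.AlgebraicComplexity

universe u v

section LocalDecomposition

variable {k : Type u} [Field k] {σ : Type v}

/-- **Local decomposition of a representation (depth form).** Let `k` be algebraically closed,
`R` a finite-dimensional commutative `k`-algebra with `dim R ≤ s` and `(nilradical R)^ν = 0`
(`1 ≤ ν`), and `f = λ(det A)` coefficientwise for an `m × m` matrix `A` of affine forms over `R`.
Then `f = Σ_{i<t} fᵢ` with `t ≤ s`, where each `fᵢ = λᵢ(det Aᵢ)` for an affine `m × m` matrix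
`Aᵢ` over a LOCAL algebra `Rᵢ` carrying a character `φᵢ : Rᵢ →ₐ[k] k` with `(ker φᵢ)^ν = 0`, and
`Σᵢ dim Rᵢ ≤ s`.  (`Rᵢ = R ⧸ 𝔪ᵢ^ν` over the maximal ideals; `R ≅ ∏ᵢ Rᵢ` by the Chinese remainder
theorem; `eq_sum_of_repr_pi`.) [cite: HrubesYehudayoff2011, §2] -/
theorem exists_local_decomposition [IsAlgClosed k] {f : MvPolynomial σ k} {m s : ℕ}
    {R : Type u} [CommRing R] [Algebra k R] [Module.Finite k R] {ν : ℕ} (hν1 : 1 ≤ ν)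
    (hν : (nilradical R) ^ ν = ⊥) (hs : Module.finrank k R ≤ s) (l : R →ₗ[k] k)
    (A : Matrix (Fin m) (Fin m) (MvPolynomial σ R)) (hA : ∀ i j, (A i j).totalDegree ≤ 1)
    (hf : ∀ d : σ →₀ ℕ, l (coeff d A.det) = coeff d f) :
    ∃ (t : ℕ) (F : Fin t → MvPolynomial σ k) (dim : Fin t → ℕ),
      t ≤ s ∧ ∑ i, dim i ≤ s ∧ f = ∑ i, F i ∧
        ∀ i, ∃ (Rᵢ : Type u) (_ : CommRing Rᵢ) (_ : Algebra k Rᵢ) (_ : Module.Finite k Rᵢ)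
          (φ : Rᵢ →ₐ[k] k), RingHom.ker (φ : Rᵢ →+* k) ^ ν = ⊥ ∧ Module.finrank k Rᵢ = dim i ∧
            ∃ (lᵢ : Rᵢ →ₗ[k] k) (Aᵢ : Matrix (Fin m) (Fin m) (MvPolynomial σ Rᵢ)),
              (∀ a b, (Aᵢ a b).totalDegree ≤ 1) ∧
                ∀ d : σ →₀ ℕ, lᵢ (coeff d Aᵢ.det) = coeff d (F i) := by
  classical
  haveI : IsArtinianRing R := IsArtinianRing.of_finite k R
  let ι := MaximalSpectrum R
  haveI : Fintype ι := Fintype.ofFinite ι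
  let Q : ι → Type u := fun I => R ⧸ I.asIdeal ^ ν
  -- the CRT isomorphism `R ≅ ∏ R ⧸ 𝔪^ν`, as a `k`-algebra isomorphism
  let e₀ : R ≃ₐ[R] (∀ I : ι, Q I) :=
    (((AlgEquiv.quotientBot R R).symm.trans
      (Ideal.quotientEquivAlgOfEq R hν.symm)).trans (IsArtinianRing.quotNilradicalPowEquivPi R ν))
  let e : R ≃ₐ[k] (∀ I : ι, Q I) := e₀.restrictScalars k
  obtain ⟨hA', hf'⟩ := repr_transport e l A hA hf
  set A' := (MvPolynomial.map (e : R →+* ∀ I : ι, Q I)).mapMatrix A with hA'def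
  set l' := l ∘ₗ e.symm.toLinearMap with hl'def
  have hdec := eq_sum_of_repr_pi l' A' hf'
  haveI hQfin : ∀ I : ι, Module.Finite k (Q I) := fun I =>
    Module.Finite.of_surjective (Ideal.Quotient.mkₐ k (I.asIdeal ^ ν)).toLinearMap
      (Ideal.Quotient.mkₐ_surjective k _)
  -- dimensions add up: `Σ dim Q I = dim R ≤ s`
  have hsum : ∑ I : ι, Module.finrank k (Q I) ≤ s := by
    rw [← Module.finrank_pi_fintype k, ← e.toLinearEquiv.finrank_eq]
    exact hs
  have hAI : ∀ (I : ι) i j,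
      (((MvPolynomial.map (Pi.evalRingHom Q I)).mapMatrix A') i j).totalDegree ≤ 1 :=
    fun I i j => by
      rw [RingHom.mapMatrix_apply, Matrix.map_apply]
      exact (Finset.sup_mono (MvPolynomial.support_map_subset _ (A' i j))).trans (hA' i j)
  -- reindex the maximal ideals by `Fin t`
  let t := Fintype.card ι
  let g : Fin t ≃ ι := (Fintype.equivFin ι).symm
  let F : ι → MvPolynomial σ k := fun I =>
    (AddMonoidAlgebra.map (l' ∘ₗ LinearMap.single k Q I).toAddMonoidHom
      ((MvPolynomial.map (Pi.evalRingHom Q I)).mapMatrix A').det : MvPolynomial σ k)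
  refine ⟨t, fun i => F (g i), fun i => Module.finrank k (Q (g i)), ?_, ?_, ?_, fun i => ?_⟩
  · exact (card_maximalSpectrum_le_finrank (k := k)).trans hs
  · calc ∑ i, Module.finrank k (Q (g i)) = ∑ I, Module.finrank k (Q I) :=
          Fintype.sum_equiv g _ _ fun _ => rfl
      _ ≤ s := hsum
  · rw [hdec]
    exact (Fintype.sum_equiv g _ _ fun _ => rfl).symm
  · haveI : (g i).asIdeal.IsMaximal := (g i).isMaximal
    obtain ⟨φ, hφ⟩ := exists_character_quotient_pow (k := k) (g i).asIdeal ν hν1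
    exact ⟨Q (g i), inferInstance, inferInstance, inferInstance, φ, hφ, rfl,
      l' ∘ₗ LinearMap.single k Q (g i), (MvPolynomial.map (Pi.evalRingHom Q (g i))).mapMatrix A',
      hAI (g i), fun d => rfl⟩

/-- **Local decomposition, `HasAlgDetRepr` form.** Over an algebraically closed field, if `f` has
an `(m, s)`-representation then `f = Σ_{i<t} fᵢ` with `t ≤ s`, each `fᵢ` represented by an affine
`m × m` matrix over a LOCAL coefficient algebra `Rᵢ` (character `φᵢ`, `(ker φᵢ)^s = 0`) with
`Σᵢ dim Rᵢ ≤ s`; in particular `fᵢ` has an `(m, dim Rᵢ)`-representation.  (`ν = dim R ≤ s` by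
`nilradical_pow_finrank_eq_bot`.)  Conversely such a sum is an `(m, Σ dim Rᵢ)`-representation
(`hasAlgDetRepr_finset_sum`): questions about the model reduce to local algebras at no cost.
[cite: HrubesYehudayoff2011, §2] -/
theorem exists_local_decomposition_of_hasAlgDetRepr [IsAlgClosed k] {f : MvPolynomial σ k}
    {m s : ℕ} (h : HasAlgDetRepr f m s) :
    ∃ (t : ℕ) (F : Fin t → MvPolynomial σ k) (dim : Fin t → ℕ),
      t ≤ s ∧ ∑ i, dim i ≤ s ∧ f = ∑ i, F i ∧
        ∀ i, ∃ (Rᵢ : Type u) (_ : CommRing Rᵢ) (_ : Algebra k Rᵢ) (_ : Module.Finite k Rᵢ)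
          (φ : Rᵢ →ₐ[k] k), RingHom.ker (φ : Rᵢ →+* k) ^ s = ⊥ ∧ Module.finrank k Rᵢ = dim i ∧
            ∃ (lᵢ : Rᵢ →ₗ[k] k) (Aᵢ : Matrix (Fin m) (Fin m) (MvPolynomial σ Rᵢ)),
              (∀ a b, (Aᵢ a b).totalDegree ≤ 1) ∧
                ∀ d : σ →₀ ℕ, lᵢ (coeff d Aᵢ.det) = coeff d (F i) := by
  obtain ⟨R, _, _, _, hR, l, A, hA, hf⟩ := h
  rcases Nat.eq_zero_or_pos s with hs0 | hs1
  · -- `s = 0`: `R = 0`, `f = 0`, the empty sum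
    subst hs0
    haveI : Subsingleton R := Module.finrank_zero_iff.mp (Nat.le_zero.mp hR)
    refine ⟨0, Fin.elim0, Fin.elim0, le_rfl, by simp, ?_, fun i => i.elim0⟩
    refine MvPolynomial.ext _ _ fun d => ?_
    rw [← hf d, Subsingleton.elim (coeff d A.det) 0, map_zero]
    simp
  have hν : (nilradical R) ^ s = ⊥ := by
    refine le_bot_iff.mp ?_
    calc (nilradical R) ^ s ≤ (nilradical R) ^ Module.finrank k R := Ideal.pow_le_pow_right hR
      _ = ⊥ := nilradical_pow_finrank_eq_bot (k := k)
  exact exists_local_decomposition hs1 hν hR l A hA hf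

end LocalDecomposition

end Summit.ValiantsHypothesis.ValiantsHypothesis.Theorems.GrenetZeonPolySizeQPAlgebra

end
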